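import Mathlib
import Literature.Computability.AlgebraicComplexity.NestFreeMatchingPoly
import HarnessLib

/-!
# Route FifoMatching — crux `NNDivisionHard` (stmt-ValiantsHypothesis-21181): FEW ARCS ARE ALWAYS AVOIDABLE —
# `|I| ≤ k`, `2k + 3 ≤ c` ⇒ some nest-free perfect matching of `[0, 2c)` avoids `I`

The existence input of the block recursion for avoiding faces (`…SplitFaceAvoiding.lean`: each recursion step needs one
nest-free perfect matching of the discarded block avoiding the arcs of `I` inside it).  Construction: for `1 ≤ ℓ ≤ k + 1`
the TWO-SHIFT matching `T_ℓ` of `[0, 2c)` — the shift `i ↦ i ± ℓ` on `[0, 2ℓ)` glued with the shift `i ↦ i ± (c − ℓ)` on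
`[2ℓ, 2c)` — is nest-free, and for `ℓ ≠ ℓ'` (both `≤ k + 1`, `2k + 3 ≤ c`) the matchings `T_ℓ`, `T_ℓ'` have NO COMMON ARC (arc
lengths `ℓ`, `c − ℓ` versus `ℓ'`, `c − ℓ'`, and `ℓ + ℓ' < c`).  Each arc of `I` therefore lies in at most one `T_ℓ`, and by
pigeonhole one of the `k + 1` matchings avoids `I`:

* ★★ `exists_nestFree_avoiding_of_card_le` — **`I.card ≤ k`, `2k + 3 ≤ c` ⇒ ∃ M ∈ nestFreeMatchings (2c) avoiding `I`.**

HONEST FRAMING: a combinatorial lemma (no complexity content); stmt-21181 stays OPEN; nothing here bears on `NNNotVP` or on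
VP ≠ VNP (NOT proved).  No definitions (the matchings are written as explicit lambdas), no named facts.
References: Chen–Deng–Du–Stanley–Yan 2007 §1 (nestings) [ChenDengDuStanleyYan2007].
-/

-- Sub = Summit single-conjunct layout: the duplicated namespace component is mandated by the tree.
set_option linter.dupNamespace false
set_option autoImplicit false

namespace Summit.ValiantsHypothesis.ValiantsHypothesis.Theorems.FifoMatching.NNDivisionHard.FewArcsAvoidable

open Finset Literature.Computability.AlgebraicComplexity

/-- ★★ **FEW ARCS ARE AVOIDABLE.**  If `I` is a set of at most `k` arc variables of `[0, 2c)` and `2k + 3 ≤ c`, then some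
nest-free perfect matching of `[0, 2c)` has no arc in `I`. [cite: ChenDengDuStanleyYan2007, §1] -/
theorem exists_nestFree_avoiding_of_card_le {k c : ℕ} (hc : 2 * k + 3 ≤ c) (I : Finset (Fin (2 * c) × Fin (2 * c)))
    (hI : I.card ≤ k) : ∃ M ∈ nestFreeMatchings (2 * c), ∀ j ∈ openers M, (j, M j) ∉ I := by
  classical
  -- the two-shift matchings, on `ℕ` and on `Fin (2c)`
  let g : ℕ → ℕ → ℕ := fun ℓ i =>
    if i < ℓ then i + ℓ else if i < 2 * ℓ then i - ℓ else if i < ℓ + c then i + (c - ℓ) else i - (c - ℓ)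
  have hg_lt : ∀ ℓ, ℓ ≤ c → ∀ i, i < 2 * c → g ℓ i < 2 * c := by
    intro ℓ hℓ i hi
    simp only [g]
    split_ifs <;> omega
  let T : ℕ → Fin (2 * c) → Fin (2 * c) := fun ℓ i =>
    if hℓ : ℓ ≤ c then ⟨g ℓ i, hg_lt ℓ hℓ i i.isLt⟩ else i
  have hT_val : ∀ ℓ, ℓ ≤ c → ∀ i : Fin (2 * c), ((T ℓ i : Fin (2 * c)) : ℕ) = g ℓ i := by
    intro ℓ hℓ i
    simp only [T, dif_pos hℓ]
  -- `T_ℓ` is a nest-free perfect matching for `1 ≤ ℓ ≤ c - 1`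
  have hT_mem : ∀ ℓ, 1 ≤ ℓ → ℓ + 1 ≤ c → T ℓ ∈ nestFreeMatchings (2 * c) := by
    intro ℓ h1 h2
    have hℓ : ℓ ≤ c := by omega
    rw [mem_nestFreeMatchings, mem_perfectMatchings]
    refine ⟨⟨fun i => ?_, fun i => ?_⟩, fun i j hij hj hji => ?_⟩
    · apply Fin.ext
      rw [hT_val ℓ hℓ, hT_val ℓ hℓ]
      have hi := i.isLt
      simp only [g]
      split_ifs <;> omega
    · intro h
      have h' := congrArg Fin.val h
      rw [hT_val ℓ hℓ] at h'
      have hi := i.isLt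
      simp only [g] at h'
      split_ifs at h' <;> omega
    · rw [Fin.lt_def] at hij hj hji
      rw [hT_val ℓ hℓ] at hj hji
      rw [hT_val ℓ hℓ] at hji
      have hi := i.isLt
      have hj' := j.isLt
      simp only [g] at hj hji
      split_ifs at hj hji <;> omega
  -- the arcs of `T_ℓ`: an opener `j` has `T_ℓ j = j + ℓ` (`j < ℓ`) or `T_ℓ j = j + (c - ℓ)` (`2ℓ ≤ j < ℓ + c`)
  have hT_arc : ∀ ℓ, ℓ ≤ c → ∀ j : Fin (2 * c), j < T ℓ j →
      ((j : ℕ) < ℓ ∧ ((T ℓ j : Fin (2 * c)) : ℕ) = (j : ℕ) + ℓ) ∨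
        (2 * ℓ ≤ (j : ℕ) ∧ (j : ℕ) < ℓ + c ∧ ((T ℓ j : Fin (2 * c)) : ℕ) = (j : ℕ) + (c - ℓ)) := by
    intro ℓ hℓ j hj
    rw [Fin.lt_def, hT_val ℓ hℓ] at hj
    rw [hT_val ℓ hℓ]
    have hj' := j.isLt
    simp only [g] at hj ⊢
    split_ifs at hj ⊢ with h1 h2 h3 <;> omega
  -- distinct two-shift matchings (`ℓ ≠ ℓ'`, both `≤ k + 1`) share no arc
  have hT_disj : ∀ ℓ ℓ', 1 ≤ ℓ → ℓ ≤ k + 1 → 1 ≤ ℓ' → ℓ' ≤ k + 1 → ℓ ≠ ℓ' →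
      ∀ j : Fin (2 * c), j < T ℓ j → j < T ℓ' j → T ℓ j ≠ T ℓ' j := by
    intro ℓ ℓ' h1 h2 h1' h2' hne j hj hj' heq
    have heqv := congrArg Fin.val heq
    rcases hT_arc ℓ (by omega) j hj with ⟨a1, a2⟩ | ⟨a1, a2, a3⟩ <;>
      rcases hT_arc ℓ' (by omega) j hj' with ⟨b1, b2⟩ | ⟨b1, b2, b3⟩ <;> omega
  -- pigeonhole over `ℓ ∈ [1, k + 1]`
  by_contra hall
  push Not at hall
  have hmeet : ∀ ℓ ∈ Finset.Icc 1 (k + 1), ∃ a ∈ I, ∃ j : Fin (2 * c), j < T ℓ j ∧ a = (j, T ℓ j) := by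
    intro ℓ hℓ
    rw [Finset.mem_Icc] at hℓ
    obtain ⟨j, hj, hjI⟩ := hall (T ℓ) (hT_mem ℓ hℓ.1 (by omega))
    exact ⟨_, hjI, j, mem_openers.1 hj, rfl⟩
  have h0c : 0 < 2 * c := by omega
  haveI : Nonempty (Fin (2 * c)) := ⟨⟨0, h0c⟩⟩
  haveI : Nonempty (Fin (2 * c) × Fin (2 * c)) := ⟨(⟨0, h0c⟩, ⟨0, h0c⟩)⟩
  choose! f hf using hmeet
  have hinj : Set.InjOn f (Finset.Icc 1 (k + 1)) := by
    intro ℓ hℓ ℓ' hℓ' hff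
    have hℓ1 := Finset.mem_Icc.1 (Finset.mem_coe.1 hℓ)
    have hℓ2 := Finset.mem_Icc.1 (Finset.mem_coe.1 hℓ')
    obtain ⟨-, j, hj, hfj⟩ := hf ℓ (Finset.mem_coe.1 hℓ)
    obtain ⟨-, j', hj', hfj'⟩ := hf ℓ' (Finset.mem_coe.1 hℓ')
    by_contra hne
    rw [hff] at hfj
    rw [hfj] at hfj'
    obtain ⟨hjj, hTT⟩ := Prod.mk.inj hfj'
    subst hjj
    exact hT_disj ℓ ℓ' hℓ1.1 hℓ1.2 hℓ2.1 hℓ2.2 hne j hj hj' hTT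
  have hle : (Finset.Icc 1 (k + 1)).card ≤ I.card := Finset.card_le_card_of_injOn f (fun ℓ hℓ => (hf ℓ hℓ).1) hinj
  rw [Nat.card_Icc] at hle
  omega

end Summit.ValiantsHypothesis.ValiantsHypothesis.Theorems.FifoMatching.NNDivisionHard.FewArcsAvoidable
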